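import Literature.NumberTheory.Automorphic.AdelicRowVectorTwist
import Literature.NumberTheory.Automorphic.MirabolicEisensteinSeries
import Literature.NumberTheory.Weil1964.ThetaSeriesProduct
import HarnessLib

/-!
# The adelic theta distribution `Θ(Φ) = Σ_{ξ ∈ X_k} Φ(ξ)` and the theta function
# `θ_Φ(x) = Σ_{ξ ∈ X_k} Φ(x + ξ)` on the Schwartz–Bruhat space `𝒮(X_A)`, `X = F^ι` — constructed and proved

Topic `NumberTheory/Weil1964`; namespace `Literature.NumberTheory.Weil1964`.  A CONSTRUCTION file: definitions
over the tree's adelic Schwartz–Bruhat space `piSchwartzBruhat F ι` (`AdelicPiSchwartzBruhatFourier`) and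
kernel-checked theorems; no named facts, no hypotheses records.  It is the concrete ("Schrödinger-model")
instance, for the vector space `X = F^ι` over a number field `F`, of the objects that Weil's Théorème 6 is about:

A. Weil, *Sur certains groupes d'opérateurs unitaires*, Acta Math. 111 (1964) 143–211 [Weil1964], Chap. III
n° 41, Théorème 6, p. 193: "Soient `X_k` un espace vectoriel de dimension finie sur `k`, et `Φ` une fonction
appartenant à `S(X_A)`.  Soit `Θ` la fonction sur `Mp(X)_A`, définie, pour tout `S ∈ Mp(X)_A`, par la formule
`Θ(S) = Σ_{ξ ∈ X_k} SΦ(ξ)`.  Alors `Θ` est une fonction continue sur `Mp(X)_A`, invariante par les translations à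
gauche déterminées par les éléments de `Mp(X)_A` de la forme `r_k(s)`, avec `s ∈ Ps(X)_k`."  (Typed skeleton of
the conclusion: `WeilThetaDatum.ThetaContinuousInvariant`, `ThetaDistribution.lean`; defining formula over bare
carriers: `ThetaSeriesDatum.thetaSeries`, `ThetaSeriesProduct.lean`.)

WHAT IS HERE (everything PROVED from the tree's adelic Poisson summation file and Mathlib):

* `ratPt F ι ξ` — the principal adelic point of `ξ ∈ F^ι` (`= ratVec F ξ` for `ι = Fin n`).
* **The theta distribution** `thetaDist F ι Φ = Σ'_{ξ ∈ F^ι} Φ(ξ)` (Weil's `Θ(S)` at `S = 1`), with, for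
  `Φ ∈ 𝒮(𝔸_F^ι)`: ABSOLUTE CONVERGENCE `summable_norm_ratPt` / `hasSum_thetaDist` (the tree's
  `summable_norm_of_mem_piSchwartzBruhat`), the bound `‖Θ(Φ)‖ ≤ Σ ‖Φ(ξ)‖`, linearity, and the packaged linear
  functional `thetaDistLM : 𝒮(𝔸_F^ι) →ₗ[ℂ] ℂ`.
* **The theta function** `thetaFun F ι Φ x = Σ'_{ξ ∈ F^ι} Φ(x + ξ)` on `X_A = 𝔸_F^ι`: absolute convergence at
  every point, `X_k`-PERIODICITY (`thetaFun_add_ratPt`, `thetaFun_add_of_mem`), CONTINUITY (`continuous_thetaFun`,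
  Weierstrass M-test on compacta from the tree's locally uniform majorants
  `exists_summable_majorant_of_mem_piSchwartzBruhat`), and its DESCENT `thetaFunQuot` to a continuous function
  on the compact quotient `𝔸_F^ι ⧸ F^ι` (`piPrincipalSubgroup`); the general M-test tool
  `continuous_tsum_of_locally_dominated` (continuity of `t ↦ Σ_ξ f ξ t` from continuity of the terms and a
  summable majorant near every point) is isolated for reuse by the theta-kernel files.
* **The operators `Φ ↦ Φ(· g)`**, `g ∈ GL_n(𝔸_F)`, on `𝒮(𝔸_Fⁿ)` (`twist`, `twistLM`, the representation
  `twistRep : GL_n(𝔸_F) →* Module.End ℂ 𝒮(𝔸_Fⁿ)` and its unit-valued form `twistUnit`), from the tree's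
  `comp_vecMul_mem_piSchwartzBruhat`; and **INVARIANCE OF `Θ` UNDER THE RATIONAL POINTS `GL_n(F)`**:
  `thetaDist_twist_ratGL` (`Θ(Φ(· γ)) = Θ(Φ)`, reindexing `ξ ↦ ξγ` of `Fⁿ`), and the companion
  `thetaFun_twist_ratGL` (`θ_{Φ(·γ)}(x) = θ_Φ(xγ)`).  This is the invariance conjunct of Théorème 6 for the
  generators `d(γ)`, `γ ∈ GL(X_k)`, of the rational pseudo-symplectic group, in the concrete model.
* **POISSON AS `Θ`-INVARIANCE OF THE FOURIER TRANSFORM**: `fourierLM ν : 𝒮 →ₗ[ℂ] 𝒮` (the tree's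
  `adelicPiFourier`, `adelicPiFourier_mem_piSchwartzBruhat`) and `thetaDist_adelicPiFourier`:
  `Θ(Φ̂) = ν(D^ι) · Θ(Φ)` for every additive Haar measure `ν` (Tate's Riemann–Roch theorem for the vector
  group, tree `tsum_eq_inv_measure_mul_tsum_adelicPiFourier`), hence `Θ(Φ̂) = Θ(Φ)` for the self-dual
  normalisation `ν(D^ι) = 1` (`thetaDist_adelicPiFourier_of_measure_eq_one`) — the invariance conjunct for the
  Weyl-element generator `d'(1)` of `Ps(X)_k`.
* **PACKAGING** as the tree's carriers: `schwartzBruhatThetaSeriesDatum F ι : ThetaSeriesDatum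
  (Module.End ℂ 𝒮(𝔸_F^ι))ˣ 𝒮(𝔸_F^ι) (ι → F)` (the group of all invertible linear operators of `𝒮(X_A)` acting
  tautologically, evaluation at principal points), `thetaSeries = Θ ∘ act` (`thetaSeries_eq_thetaDist`),
  absolute summability everywhere (`absSummableAt`), the STABILISER SUBGROUP `thetaStabilizer F ι` of `Θ`, the
  `WeilThetaDatum` `schwartzBruhatWeilThetaDatum` with `rat := thetaStabilizer`, and the PROVED invariance
  conjunct `theta Φ (γ * S) = theta Φ S` for `γ ∈ rat` (`schwartzBruhatWeilThetaDatum_theta_invariant`);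
  `twistUnit_ratGL_mem_thetaStabilizer` puts the rational points of `GL_n` in `rat`.

NOT HERE (later files of the same construction): stability of `𝒮(X_A)` under multiplication by adelic
second-degree characters `ψ(q(x))` and the corresponding invariance for the generators `t(σ)`, `σ ∈ Sym(X_k)`;
a topology on `𝒮(X_A)` and the continuity conjunct of Théorème 6 on a metaplectic-type group; the dual-pair
theta kernel `θ_Φ(g, h)` (tree `ThetaKernelDualPair.ThetaKernelDatum`), which consumes the present file once the
global Weil representation operators are available.

## References

* [Weil1964] A. Weil, *Sur certains groupes d'opérateurs unitaires*, Acta Math. 111 (1964), Chap. III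
  n° 38–41, Théorème 6 p. 193.
* [CasselsFrohlichANT1967] J. Tate, *Fourier analysis in number fields and Hecke's zeta-functions*, in
  Cassels–Fröhlich (eds.), *Algebraic Number Theory* (1967), Ch. XV, §4.2 (Riemann–Roch / Poisson).
* [WeilBNT1967] A. Weil, *Basic Number Theory* (1967), Ch. VII §2 (standard functions), Ch. IV §2 (`𝔸/k`).
-/

set_option autoImplicit false

noncomputable section

open scoped BigOperators NNReal ENNReal Matrix Topology
open NumberField MeasureTheory MeasureTheory.Measure Filter

namespace Literature.NumberTheory.Weil1964

open Literature.NumberTheory.Automorphic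

/-! ### Principal adelic points `X_k ⊂ X_A` -/

section RatPt

variable (F : Type) [Field F] [NumberField F] (ι : Type)

/-- The principal adelic point of `ξ ∈ F^ι`: coordinatewise `algebraMap F 𝔸_F` (Weil's `X_k ⊂ X_A`).
[folklore] -/
def ratPt (ξ : ι → F) : ι → AdeleRing (𝓞 F) F := fun i => algebraMap F (AdeleRing (𝓞 F) F) (ξ i)

variable {F ι}

/-- Coordinates of a principal point. [folklore] -/
@[simp] theorem ratPt_apply (ξ : ι → F) (i : ι) : ratPt F ι ξ i = algebraMap F (AdeleRing (𝓞 F) F) (ξ i) :=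
  rfl

/-- `ratPt 0 = 0`. [folklore] -/
@[simp] theorem ratPt_zero : ratPt F ι 0 = 0 := by
  funext i
  simp [ratPt]

/-- `ratPt` is additive. [folklore] -/
theorem ratPt_add (ξ η : ι → F) : ratPt F ι (ξ + η) = ratPt F ι ξ + ratPt F ι η := by
  funext i
  simp [ratPt]

/-- `ratPt` commutes with negation. [folklore] -/
theorem ratPt_neg (ξ : ι → F) : ratPt F ι (-ξ) = -ratPt F ι ξ := by
  funext i
  simp [ratPt]

/-- `ratPt` is subtractive. [folklore] -/
theorem ratPt_sub (ξ η : ι → F) : ratPt F ι (ξ - η) = ratPt F ι ξ - ratPt F ι η := by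
  funext i
  simp [ratPt]

variable (F ι) in
/-- `ratPt` as a homomorphism of additive groups `F^ι →+ 𝔸_F^ι`. [folklore] -/
def ratPtHom : (ι → F) →+ (ι → AdeleRing (𝓞 F) F) where
  toFun := ratPt F ι
  map_zero' := ratPt_zero
  map_add' := ratPt_add

/-- Unfolding of `ratPtHom`. [folklore] -/
@[simp] theorem ratPtHom_apply (ξ : ι → F) : ratPtHom F ι ξ = ratPt F ι ξ := rfl

/-- `ratPt` is injective (`F → 𝔸_F` is). [folklore] -/
theorem ratPt_injective : Function.Injective (ratPt F ι) := by
  intro ξ η h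
  funext i
  exact AdeleRing.algebraMap_injective (𝓞 F) F (congr_fun h i)

/-- Principal points lie in the lattice `F^ι = piPrincipalSubgroup F ι` of `AdelicPoissonSummation`. [folklore] -/
theorem ratPt_mem_piPrincipalSubgroup (ξ : ι → F) : ratPt F ι ξ ∈ piPrincipalSubgroup F ι :=
  mem_piPrincipalSubgroup_iff.2 fun i => ⟨ξ i, rfl⟩

/-- Every element of the lattice `piPrincipalSubgroup F ι` is a principal point. [folklore] -/
theorem exists_ratPt_eq_of_mem_piPrincipalSubgroup {v : ι → AdeleRing (𝓞 F) F}
    (hv : v ∈ piPrincipalSubgroup F ι) : ∃ ξ : ι → F, ratPt F ι ξ = v := by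
  have hv' := mem_piPrincipalSubgroup_iff.1 hv
  choose ξ hξ using hv'
  exact ⟨ξ, funext hξ⟩

/-- The range of `ratPtHom` is the lattice `piPrincipalSubgroup F ι`. [folklore] -/
theorem range_ratPtHom : (ratPtHom F ι).range = piPrincipalSubgroup F ι := by
  ext v
  constructor
  · rintro ⟨ξ, rfl⟩
    exact ratPt_mem_piPrincipalSubgroup ξ
  · intro hv
    obtain ⟨ξ, hξ⟩ := exists_ratPt_eq_of_mem_piPrincipalSubgroup hv
    exact ⟨ξ, hξ⟩

/-- For `ι = Fin n`, `ratPt` is the tree's `ratVec` (`MirabolicEisensteinSeries`). [folklore] -/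
theorem ratPt_eq_ratVec {n : ℕ} (ξ : Fin n → F) : ratPt F (Fin n) ξ = ratVec F ξ := rfl

end RatPt

/-! ### The theta distribution `Θ(Φ) = Σ_{ξ ∈ X_k} Φ(ξ)` -/

section ThetaDist

variable (F : Type) [Field F] [NumberField F] (ι : Type)

/-- **The theta distribution** `Θ(Φ) = Σ_{ξ ∈ X_k} Φ(ξ)` on functions `Φ : X_A → ℂ`, `X = F^ι` — Weil's
`Θ(S) = Σ_{ξ ∈ X_k} SΦ(ξ)` [Weil1964, n° 41, Thm 6, p. 193] at `S = 1` (Mathlib `tsum`; for `Φ ∈ 𝒮(X_A)` the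
series converges absolutely, `hasSum_thetaDist`). [cite: Weil1964, Chap. III n° 41, Thm 6 p. 193] -/
def thetaDist (Φ : (ι → AdeleRing (𝓞 F) F) → ℂ) : ℂ :=
  ∑' ξ : ι → F, Φ (ratPt F ι ξ)

variable {F ι}

/-- Unfolding of `thetaDist`. [folklore] -/
theorem thetaDist_def (Φ : (ι → AdeleRing (𝓞 F) F) → ℂ) :
    thetaDist F ι Φ = ∑' ξ : ι → F, Φ (ratPt F ι ξ) := rfl

/-- `Θ(0) = 0`. [folklore] -/
@[simp] theorem thetaDist_zero : thetaDist F ι 0 = 0 := by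
  simp [thetaDist]

/-- `Θ` is homogeneous (no summability needed). [folklore] -/
theorem thetaDist_smul (a : ℂ) (Φ : (ι → AdeleRing (𝓞 F) F) → ℂ) :
    thetaDist F ι (a • Φ) = a * thetaDist F ι Φ := by
  simp only [thetaDist, Pi.smul_apply, smul_eq_mul]
  exact tsum_mul_left

/-- `Θ(-Φ) = -Θ(Φ)` (no summability needed). [folklore] -/
theorem thetaDist_neg (Φ : (ι → AdeleRing (𝓞 F) F) → ℂ) : thetaDist F ι (-Φ) = -thetaDist F ι Φ := by
  simp only [thetaDist, Pi.neg_apply]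
  exact tsum_neg

variable [Fintype ι]

/-- **Absolute convergence** `Σ_{ξ ∈ X_k} |Φ(ξ)| < ∞` for `Φ ∈ 𝒮(X_A)` (the tree's
`summable_norm_of_mem_piSchwartzBruhat`; Weil, n° 41, Lemme 5 for the Schwartz–Bruhat case). [folklore] -/
theorem summable_norm_ratPt {Φ : (ι → AdeleRing (𝓞 F) F) → ℂ} (hΦ : Φ ∈ piSchwartzBruhat F ι) :
    Summable fun ξ : ι → F => ‖Φ (ratPt F ι ξ)‖ :=
  summable_norm_of_mem_piSchwartzBruhat hΦ

/-- The series `Σ_{ξ ∈ X_k} Φ(ξ)` is summable for `Φ ∈ 𝒮(X_A)`. [folklore] -/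
theorem summable_ratPt {Φ : (ι → AdeleRing (𝓞 F) F) → ℂ} (hΦ : Φ ∈ piSchwartzBruhat F ι) :
    Summable fun ξ : ι → F => Φ (ratPt F ι ξ) :=
  (summable_norm_ratPt hΦ).of_norm

/-- `Θ(Φ)` IS the sum of the absolutely convergent series `Σ_{ξ ∈ X_k} Φ(ξ)`, `Φ ∈ 𝒮(X_A)`. [folklore] -/
theorem hasSum_thetaDist {Φ : (ι → AdeleRing (𝓞 F) F) → ℂ} (hΦ : Φ ∈ piSchwartzBruhat F ι) :
    HasSum (fun ξ : ι → F => Φ (ratPt F ι ξ)) (thetaDist F ι Φ) :=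
  (summable_ratPt hΦ).hasSum

/-- `‖Θ(Φ)‖ ≤ Σ_{ξ ∈ X_k} ‖Φ(ξ)‖`. [folklore] -/
theorem norm_thetaDist_le {Φ : (ι → AdeleRing (𝓞 F) F) → ℂ} (hΦ : Φ ∈ piSchwartzBruhat F ι) :
    ‖thetaDist F ι Φ‖ ≤ ∑' ξ : ι → F, ‖Φ (ratPt F ι ξ)‖ :=
  norm_tsum_le_tsum_norm (summable_norm_ratPt hΦ)

/-- `Θ` is additive on `𝒮(X_A)`. [folklore] -/
theorem thetaDist_add {Φ Ψ : (ι → AdeleRing (𝓞 F) F) → ℂ} (hΦ : Φ ∈ piSchwartzBruhat F ι)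
    (hΨ : Ψ ∈ piSchwartzBruhat F ι) : thetaDist F ι (Φ + Ψ) = thetaDist F ι Φ + thetaDist F ι Ψ := by
  simp only [thetaDist, Pi.add_apply]
  exact (summable_ratPt hΦ).tsum_add (summable_ratPt hΨ)

/-- `Θ` is subtractive on `𝒮(X_A)`. [folklore] -/
theorem thetaDist_sub {Φ Ψ : (ι → AdeleRing (𝓞 F) F) → ℂ} (hΦ : Φ ∈ piSchwartzBruhat F ι)
    (hΨ : Ψ ∈ piSchwartzBruhat F ι) : thetaDist F ι (Φ - Ψ) = thetaDist F ι Φ - thetaDist F ι Ψ := by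
  rw [sub_eq_add_neg, thetaDist_add hΦ (neg_mem hΨ), thetaDist_neg, ← sub_eq_add_neg]

variable (F ι) in
/-- **The theta distribution as a linear functional** `Θ : 𝒮(X_A) →ₗ[ℂ] ℂ` (Weil's "distribution
tempérée" `Θ` of n° 41, in the concrete model). [cite: Weil1964, Chap. III n° 41, Thm 6 p. 193] -/
def thetaDistLM : piSchwartzBruhat F ι →ₗ[ℂ] ℂ where
  toFun Φ := thetaDist F ι (Φ : (ι → AdeleRing (𝓞 F) F) → ℂ)
  map_add' Φ Ψ := by
    rw [Submodule.coe_add]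
    exact thetaDist_add Φ.2 Ψ.2
  map_smul' a Φ := by
    rw [Submodule.coe_smul, RingHom.id_apply, smul_eq_mul]
    exact thetaDist_smul a _

/-- Unfolding of `thetaDistLM`. [folklore] -/
@[simp] theorem thetaDistLM_apply (Φ : piSchwartzBruhat F ι) :
    thetaDistLM F ι Φ = thetaDist F ι (Φ : (ι → AdeleRing (𝓞 F) F) → ℂ) := rfl

end ThetaDist

/-! ### A Weierstrass M-test with local majorants -/

section MTest

/-- **M-test, local form**: if every term `t ↦ f ξ t` is continuous and every point has a neighbourhood on
which the family is dominated by a summable sequence, then `t ↦ Σ'_ξ f ξ t` is continuous.  (Mathlib's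
`continuousOn_tsum` on each such neighbourhood.) [folklore] -/
theorem continuous_tsum_of_locally_dominated {T : Type*} [TopologicalSpace T] {α : Type*}
    {E : Type*} [NormedAddCommGroup E] [CompleteSpace E] {f : α → T → E} (hf : ∀ ξ, Continuous (f ξ))
    (hb : ∀ t₀ : T, ∃ V ∈ 𝓝 t₀, ∃ u : α → ℝ, Summable u ∧ ∀ ξ, ∀ t ∈ V, ‖f ξ t‖ ≤ u ξ) :
    Continuous fun t => ∑' ξ, f ξ t := by
  refine continuous_iff_continuousAt.2 fun t₀ => ?_
  obtain ⟨V, hV, u, hu, hle⟩ := hb t₀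
  have hcont : ContinuousOn (fun t => ∑' ξ, f ξ t) V :=
    continuousOn_tsum (fun ξ => (hf ξ).continuousOn) hu fun ξ t ht => hle ξ t ht
  exact hcont.continuousAt hV

/-- **M-test on a locally compact space**: continuity of the terms and a summable majorant on every compact
set give continuity of the sum. [folklore] -/
theorem continuous_tsum_of_dominated_on_compacts {T : Type*} [TopologicalSpace T] [LocallyCompactSpace T]
    {α : Type*} {E : Type*} [NormedAddCommGroup E] [CompleteSpace E] {f : α → T → E}
    (hf : ∀ ξ, Continuous (f ξ))
    (hb : ∀ C : Set T, IsCompact C → ∃ u : α → ℝ, Summable u ∧ ∀ ξ, ∀ t ∈ C, ‖f ξ t‖ ≤ u ξ) :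
    Continuous fun t => ∑' ξ, f ξ t := by
  refine continuous_tsum_of_locally_dominated hf fun t₀ => ?_
  obtain ⟨C, hC, hCn⟩ := exists_compact_mem_nhds t₀
  obtain ⟨u, hu, hle⟩ := hb C hC
  exact ⟨C, hCn, u, hu, hle⟩

end MTest

/-! ### The theta function `θ_Φ(x) = Σ_{ξ ∈ X_k} Φ(x + ξ)` on `X_A` and on `X_A / X_k` -/

section ThetaFun

variable (F : Type) [Field F] [NumberField F] (ι : Type)

/-- **The theta function** `θ_Φ(x) = Σ_{ξ ∈ X_k} Φ(x + ξ)` of `Φ : X_A → ℂ` (the periodisation of `Φ` over the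
lattice `X_k`; `θ_Φ(0) = Θ(Φ)`).  For `Φ ∈ 𝒮(X_A)` it converges absolutely at every point, is continuous and
`X_k`-periodic. [cite: WeilBNT1967, Ch. VII §2] -/
def thetaFun (Φ : (ι → AdeleRing (𝓞 F) F) → ℂ) (x : ι → AdeleRing (𝓞 F) F) : ℂ :=
  ∑' ξ : ι → F, Φ (x + ratPt F ι ξ)

variable {F ι}

/-- Unfolding of `thetaFun`. [folklore] -/
theorem thetaFun_apply (Φ : (ι → AdeleRing (𝓞 F) F) → ℂ) (x : ι → AdeleRing (𝓞 F) F) :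
    thetaFun F ι Φ x = ∑' ξ : ι → F, Φ (x + ratPt F ι ξ) := rfl

/-- `θ_Φ(0) = Θ(Φ)`. [folklore] -/
@[simp] theorem thetaFun_zero_eq_thetaDist (Φ : (ι → AdeleRing (𝓞 F) F) → ℂ) :
    thetaFun F ι Φ 0 = thetaDist F ι Φ := by
  simp [thetaFun, thetaDist]

/-- `θ_Φ(x) = Θ(Φ(x + ·))`: the theta function is the theta distribution of the translate. [folklore] -/
theorem thetaFun_eq_thetaDist_translate (Φ : (ι → AdeleRing (𝓞 F) F) → ℂ) (x : ι → AdeleRing (𝓞 F) F) :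
    thetaFun F ι Φ x = thetaDist F ι (fun v => Φ (x + v)) := rfl

/-- **`X_k`-periodicity**: `θ_Φ(x + η) = θ_Φ(x)` for `η ∈ X_k` (reindex `ξ ↦ η + ξ`; no summability needed).
[folklore] -/
theorem thetaFun_add_ratPt (Φ : (ι → AdeleRing (𝓞 F) F) → ℂ) (x : ι → AdeleRing (𝓞 F) F) (η : ι → F) :
    thetaFun F ι Φ (x + ratPt F ι η) = thetaFun F ι Φ x := by
  simp only [thetaFun, add_assoc, ← ratPt_add]
  exact (Equiv.addLeft η).tsum_eq fun ξ => Φ (x + ratPt F ι ξ)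

/-- `X_k`-periodicity on the left: `θ_Φ(η + x) = θ_Φ(x)`. [folklore] -/
theorem thetaFun_ratPt_add (Φ : (ι → AdeleRing (𝓞 F) F) → ℂ) (η : ι → F) (x : ι → AdeleRing (𝓞 F) F) :
    thetaFun F ι Φ (ratPt F ι η + x) = thetaFun F ι Φ x := by
  rw [add_comm, thetaFun_add_ratPt]

/-- `X_k`-periodicity for lattice elements: `θ_Φ(x + ℓ) = θ_Φ(x)` for `ℓ ∈ piPrincipalSubgroup F ι`.
[folklore] -/
theorem thetaFun_add_of_mem (Φ : (ι → AdeleRing (𝓞 F) F) → ℂ) (x : ι → AdeleRing (𝓞 F) F)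
    {ℓ : ι → AdeleRing (𝓞 F) F} (hℓ : ℓ ∈ piPrincipalSubgroup F ι) :
    thetaFun F ι Φ (x + ℓ) = thetaFun F ι Φ x := by
  obtain ⟨η, rfl⟩ := exists_ratPt_eq_of_mem_piPrincipalSubgroup hℓ
  exact thetaFun_add_ratPt Φ x η

/-- `θ_Φ(ξ) = Θ(Φ)` at every principal point `ξ ∈ X_k`. [folklore] -/
theorem thetaFun_ratPt (Φ : (ι → AdeleRing (𝓞 F) F) → ℂ) (η : ι → F) :
    thetaFun F ι Φ (ratPt F ι η) = thetaDist F ι Φ := by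
  rw [← zero_add (ratPt F ι η), thetaFun_add_ratPt, thetaFun_zero_eq_thetaDist]

/-- `θ_Φ` is constant on the cosets of `X_k`. [folklore] -/
theorem thetaFun_congr_leftRel (Φ : (ι → AdeleRing (𝓞 F) F) → ℂ) {x y : ι → AdeleRing (𝓞 F) F}
    (h : QuotientAddGroup.leftRel (piPrincipalSubgroup F ι) x y) : thetaFun F ι Φ x = thetaFun F ι Φ y := by
  rw [QuotientAddGroup.leftRel_apply] at h
  have : y = x + (-x + y) := by abel
  rw [this, thetaFun_add_of_mem Φ x h]

variable (F ι) in
/-- **The theta function on the compact quotient `X_A / X_k`** (descent of the `X_k`-periodic `θ_Φ`).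
[cite: WeilBNT1967, Ch. VII §2] -/
def thetaFunQuot (Φ : (ι → AdeleRing (𝓞 F) F) → ℂ) :
    (ι → AdeleRing (𝓞 F) F) ⧸ piPrincipalSubgroup F ι → ℂ :=
  Quotient.lift (thetaFun F ι Φ) fun _ _ h => thetaFun_congr_leftRel Φ h

/-- `θ_Φ` on the quotient evaluated at a class is `θ_Φ` at a representative. [folklore] -/
@[simp] theorem thetaFunQuot_mk (Φ : (ι → AdeleRing (𝓞 F) F) → ℂ) (x : ι → AdeleRing (𝓞 F) F) :
    thetaFunQuot F ι Φ (QuotientAddGroup.mk x) = thetaFun F ι Φ x := rfl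

/-- `thetaFunQuot ∘ mk = thetaFun`. [folklore] -/
theorem thetaFunQuot_comp_mk (Φ : (ι → AdeleRing (𝓞 F) F) → ℂ) :
    thetaFunQuot F ι Φ ∘ QuotientAddGroup.mk = thetaFun F ι Φ := rfl

/-- The value of `θ_Φ` at the origin class is `Θ(Φ)`. [folklore] -/
theorem thetaFunQuot_zero {Φ : (ι → AdeleRing (𝓞 F) F) → ℂ} :
    thetaFunQuot F ι Φ (0 : (ι → AdeleRing (𝓞 F) F) ⧸ piPrincipalSubgroup F ι) = thetaDist F ι Φ := by
  rw [← QuotientAddGroup.mk_zero, thetaFunQuot_mk, thetaFun_zero_eq_thetaDist]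

/-- `θ` is homogeneous in `Φ`. [folklore] -/
theorem thetaFun_smul (a : ℂ) (Φ : (ι → AdeleRing (𝓞 F) F) → ℂ) (x : ι → AdeleRing (𝓞 F) F) :
    thetaFun F ι (a • Φ) x = a * thetaFun F ι Φ x := by
  simp only [thetaFun, Pi.smul_apply, smul_eq_mul]
  exact tsum_mul_left

variable [Fintype ι]

/-- **Absolute convergence of `θ_Φ(x)` at every point**, `Φ ∈ 𝒮(X_A)` (majorant on the compact `{x}`).
[folklore] -/
theorem summable_norm_thetaFun_term {Φ : (ι → AdeleRing (𝓞 F) F) → ℂ} (hΦ : Φ ∈ piSchwartzBruhat F ι)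
    (x : ι → AdeleRing (𝓞 F) F) : Summable fun ξ : ι → F => ‖Φ (x + ratPt F ι ξ)‖ := by
  obtain ⟨u, hu, hb⟩ := exists_summable_majorant_of_mem_piSchwartzBruhat hΦ (isCompact_singleton (x := x))
  exact Summable.of_nonneg_of_le (fun _ => norm_nonneg _) (fun ξ => hb x (Set.mem_singleton x) ξ) hu

/-- Summability of the terms of `θ_Φ(x)`. [folklore] -/
theorem summable_thetaFun_term {Φ : (ι → AdeleRing (𝓞 F) F) → ℂ} (hΦ : Φ ∈ piSchwartzBruhat F ι)
    (x : ι → AdeleRing (𝓞 F) F) : Summable fun ξ : ι → F => Φ (x + ratPt F ι ξ) :=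
  (summable_norm_thetaFun_term hΦ x).of_norm

/-- `θ_Φ(x)` is the sum of its series. [folklore] -/
theorem hasSum_thetaFun {Φ : (ι → AdeleRing (𝓞 F) F) → ℂ} (hΦ : Φ ∈ piSchwartzBruhat F ι)
    (x : ι → AdeleRing (𝓞 F) F) : HasSum (fun ξ : ι → F => Φ (x + ratPt F ι ξ)) (thetaFun F ι Φ x) :=
  (summable_thetaFun_term hΦ x).hasSum

/-- `‖θ_Φ(x)‖ ≤ Σ_ξ ‖Φ(x + ξ)‖`. [folklore] -/
theorem norm_thetaFun_le {Φ : (ι → AdeleRing (𝓞 F) F) → ℂ} (hΦ : Φ ∈ piSchwartzBruhat F ι)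
    (x : ι → AdeleRing (𝓞 F) F) : ‖thetaFun F ι Φ x‖ ≤ ∑' ξ : ι → F, ‖Φ (x + ratPt F ι ξ)‖ :=
  norm_tsum_le_tsum_norm (summable_norm_thetaFun_term hΦ x)

/-- **Continuity of the theta function** `x ↦ θ_Φ(x)` on `X_A`, `Φ ∈ 𝒮(X_A)`: M-test on compacta with the
tree's locally uniform summable majorants. [cite: WeilBNT1967, Ch. VII §2] -/
theorem continuous_thetaFun {Φ : (ι → AdeleRing (𝓞 F) F) → ℂ} (hΦ : Φ ∈ piSchwartzBruhat F ι) :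
    Continuous (thetaFun F ι Φ) := by
  haveI : LocallyCompactSpace (AdeleRing (𝓞 F) F) := locallyCompactSpace_adeleRing' F
  have hc : Continuous Φ := continuous_of_mem_piSchwartzBruhat hΦ
  refine continuous_tsum_of_dominated_on_compacts (f := fun (ξ : ι → F) (x : ι → AdeleRing (𝓞 F) F) =>
    Φ (x + ratPt F ι ξ)) (fun ξ => hc.comp (continuous_id.add continuous_const)) fun C hC => ?_
  obtain ⟨u, hu, hb⟩ := exists_summable_majorant_of_mem_piSchwartzBruhat hΦ hC
  exact ⟨u, hu, fun ξ x hx => hb x hx ξ⟩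

/-- **Continuity of `θ_Φ` on `X_A / X_k`**, `Φ ∈ 𝒮(X_A)`. [folklore] -/
theorem continuous_thetaFunQuot {Φ : (ι → AdeleRing (𝓞 F) F) → ℂ} (hΦ : Φ ∈ piSchwartzBruhat F ι) :
    Continuous (thetaFunQuot F ι Φ) := by
  rw [(QuotientAddGroup.isQuotientMap_mk (piPrincipalSubgroup F ι)).continuous_iff, thetaFunQuot_comp_mk]
  exact continuous_thetaFun hΦ

/-- `θ` is additive in `Φ` on `𝒮(X_A)`. [folklore] -/
theorem thetaFun_add {Φ Ψ : (ι → AdeleRing (𝓞 F) F) → ℂ} (hΦ : Φ ∈ piSchwartzBruhat F ι)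
    (hΨ : Ψ ∈ piSchwartzBruhat F ι) (x : ι → AdeleRing (𝓞 F) F) :
    thetaFun F ι (Φ + Ψ) x = thetaFun F ι Φ x + thetaFun F ι Ψ x := by
  simp only [thetaFun, Pi.add_apply]
  exact (summable_thetaFun_term hΦ x).tsum_add (summable_thetaFun_term hΨ x)

end ThetaFun

/-! ### The operators `Φ ↦ Φ(· g)`, `g ∈ GL_n(𝔸_F)`, and invariance of `Θ` under `GL_n(F)` -/

section Twist

variable (F : Type) [Field F] [NumberField F] {n : ℕ}

/-- The rational points `GL_n(F) → GL_n(𝔸_F)` (entrywise `algebraMap`; the tree's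
`Matrix.GeneralLinearGroup.map (algebraMap F 𝔸_F)` of `MirabolicEisensteinSeries.ratVec_vecMul`). [folklore] -/
abbrev ratGL (γ : GL (Fin n) F) : GL (Fin n) (AdeleRing (𝓞 F) F) :=
  Matrix.GeneralLinearGroup.map (algebraMap F (AdeleRing (𝓞 F) F)) γ

variable {F}

/-- `ratPt (ξ γ) = (ratPt ξ) γ` for `γ ∈ GL_n(F)` (the tree's `ratVec_vecMul`). [folklore] -/
theorem ratPt_vecMul (ξ : Fin n → F) (γ : GL (Fin n) F) :
    ratPt F (Fin n) (ξ ᵥ* (γ : Matrix (Fin n) (Fin n) F)) =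
      ratPt F (Fin n) ξ ᵥ* ((ratGL F γ : GL (Fin n) (AdeleRing (𝓞 F) F)) :
        Matrix (Fin n) (Fin n) (AdeleRing (𝓞 F) F)) :=
  ratVec_vecMul ξ γ

variable (F) in
/-- **The operator `Φ ↦ Φ(· g)`** on functions `𝔸_Fⁿ → ℂ`, `g ∈ GL_n(𝔸_F)` (row vectors times `g`; Weil's
`d(γ)`-type operators of the Schrödinger model, up to the module character handled elsewhere). [folklore] -/
def twist (g : GL (Fin n) (AdeleRing (𝓞 F) F)) (Φ : (Fin n → AdeleRing (𝓞 F) F) → ℂ) :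
    (Fin n → AdeleRing (𝓞 F) F) → ℂ :=
  fun x => Φ (x ᵥ* (g : Matrix (Fin n) (Fin n) (AdeleRing (𝓞 F) F)))

/-- Unfolding of `twist`. [folklore] -/
@[simp] theorem twist_apply (g : GL (Fin n) (AdeleRing (𝓞 F) F)) (Φ : (Fin n → AdeleRing (𝓞 F) F) → ℂ)
    (x : Fin n → AdeleRing (𝓞 F) F) :
    twist F g Φ x = Φ (x ᵥ* (g : Matrix (Fin n) (Fin n) (AdeleRing (𝓞 F) F))) := rfl

/-- `twist 1 = id`. [folklore] -/
@[simp] theorem twist_one (Φ : (Fin n → AdeleRing (𝓞 F) F) → ℂ) : twist F 1 Φ = Φ := by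
  funext x
  simp [twist]

/-- `twist (g h) = twist g ∘ twist h` (a left action: `Φ((x g) h) = (Φ(· h))(x g)`). [folklore] -/
theorem twist_mul (g h : GL (Fin n) (AdeleRing (𝓞 F) F)) (Φ : (Fin n → AdeleRing (𝓞 F) F) → ℂ) :
    twist F (g * h) Φ = twist F g (twist F h Φ) := by
  funext x
  simp [twist, Matrix.vecMul_vecMul]

/-- `twist` is additive in `Φ`. [folklore] -/
theorem twist_add (g : GL (Fin n) (AdeleRing (𝓞 F) F)) (Φ Ψ : (Fin n → AdeleRing (𝓞 F) F) → ℂ) :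
    twist F g (Φ + Ψ) = twist F g Φ + twist F g Ψ := rfl

/-- `twist` is homogeneous in `Φ`. [folklore] -/
theorem twist_smul (g : GL (Fin n) (AdeleRing (𝓞 F) F)) (a : ℂ) (Φ : (Fin n → AdeleRing (𝓞 F) F) → ℂ) :
    twist F g (a • Φ) = a • twist F g Φ := rfl

/-- **`𝒮(𝔸_Fⁿ)` is stable under `Φ ↦ Φ(· g)`** (the tree's `comp_vecMul_mem_piSchwartzBruhat`). [folklore] -/
theorem twist_mem {Φ : (Fin n → AdeleRing (𝓞 F) F) → ℂ} (hΦ : Φ ∈ piSchwartzBruhat F (Fin n))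
    (g : GL (Fin n) (AdeleRing (𝓞 F) F)) : twist F g Φ ∈ piSchwartzBruhat F (Fin n) :=
  comp_vecMul_mem_piSchwartzBruhat hΦ g

variable (F) in
/-- `Φ ↦ Φ(· g)` as a linear endomorphism of `𝒮(𝔸_Fⁿ)`. [folklore] -/
def twistLM (g : GL (Fin n) (AdeleRing (𝓞 F) F)) :
    piSchwartzBruhat F (Fin n) →ₗ[ℂ] piSchwartzBruhat F (Fin n) where
  toFun Φ := ⟨twist F g (Φ : (Fin n → AdeleRing (𝓞 F) F) → ℂ), twist_mem Φ.2 g⟩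
  map_add' Φ Ψ := by
    ext x
    rfl
  map_smul' a Φ := by
    ext x
    rfl

/-- Unfolding of `twistLM` on underlying functions. [folklore] -/
@[simp] theorem coe_twistLM (g : GL (Fin n) (AdeleRing (𝓞 F) F)) (Φ : piSchwartzBruhat F (Fin n)) :
    ((twistLM F g Φ : piSchwartzBruhat F (Fin n)) : (Fin n → AdeleRing (𝓞 F) F) → ℂ) =
      twist F g (Φ : (Fin n → AdeleRing (𝓞 F) F) → ℂ) := rfl

/-- `twistLM 1 = 1`. [folklore] -/
theorem twistLM_one : twistLM F (1 : GL (Fin n) (AdeleRing (𝓞 F) F)) = 1 := by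
  ext Φ x
  simp [twistLM]

/-- `twistLM (g h) = twistLM g * twistLM h`. [folklore] -/
theorem twistLM_mul (g h : GL (Fin n) (AdeleRing (𝓞 F) F)) :
    twistLM F (g * h) = twistLM F g * twistLM F h := by
  ext Φ x
  simp [twistLM, Matrix.vecMul_vecMul]

variable (F n) in
/-- **The representation `g ↦ (Φ ↦ Φ(· g))` of `GL_n(𝔸_F)` on `𝒮(𝔸_Fⁿ)`** as a monoid homomorphism into
the linear endomorphisms. [folklore] -/
def twistRep : GL (Fin n) (AdeleRing (𝓞 F) F) →* Module.End ℂ (piSchwartzBruhat F (Fin n)) where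
  toFun := twistLM F
  map_one' := twistLM_one
  map_mul' := twistLM_mul

/-- Unfolding of `twistRep`. [folklore] -/
@[simp] theorem twistRep_apply (g : GL (Fin n) (AdeleRing (𝓞 F) F)) : twistRep F n g = twistLM F g := rfl

variable (F n) in
/-- The same representation with values in the GROUP of invertible linear operators of `𝒮(𝔸_Fⁿ)`.
[folklore] -/
def twistUnit : GL (Fin n) (AdeleRing (𝓞 F) F) →* (Module.End ℂ (piSchwartzBruhat F (Fin n)))ˣ :=
  (twistRep F n).toHomUnits

/-- Unfolding of `twistUnit`. [folklore] -/
@[simp] theorem coe_twistUnit (g : GL (Fin n) (AdeleRing (𝓞 F) F)) :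
    ((twistUnit F n g : (Module.End ℂ (piSchwartzBruhat F (Fin n)))ˣ) :
      Module.End ℂ (piSchwartzBruhat F (Fin n))) = twistLM F g := rfl

/-- **Invariance of `Θ` under the rational points of `GL_n`**: `Θ(Φ(· γ)) = Θ(Φ)` for `γ ∈ GL_n(F)` and
EVERY `Φ : 𝔸_Fⁿ → ℂ` (reindexing of `Σ_{ξ ∈ Fⁿ}` along the bijection `ξ ↦ ξγ` of `Fⁿ`, the tree's
`MirabolicEisensteinSeries.vecMulEquiv`; no convergence needed).  This is the invariance conjunct of
[Weil1964, Thm 6] for the generators `d(γ)`, `γ ∈ GL(X_k)`, in the concrete model.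
[cite: Weil1964, Chap. III n° 41, Thm 6 p. 193] -/
theorem thetaDist_twist_ratGL (Φ : (Fin n → AdeleRing (𝓞 F) F) → ℂ) (γ : GL (Fin n) F) :
    thetaDist F (Fin n) (twist F (ratGL F γ) Φ) = thetaDist F (Fin n) Φ := by
  simp only [thetaDist, twist_apply]
  have h : ∀ ξ : Fin n → F,
      Φ (ratPt F (Fin n) ξ ᵥ* ((ratGL F γ : GL (Fin n) (AdeleRing (𝓞 F) F)) :
        Matrix (Fin n) (Fin n) (AdeleRing (𝓞 F) F))) =
      Φ (ratPt F (Fin n) (MirabolicEisensteinSeries.vecMulEquiv γ ξ)) := fun ξ => by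
    rw [vecMulEquiv_apply, ratPt_vecMul]
  simp_rw [h]
  exact (MirabolicEisensteinSeries.vecMulEquiv γ).toEquiv.tsum_eq fun ξ => Φ (ratPt F (Fin n) ξ)

/-- The same for the packaged operator `twistLM`. [folklore] -/
theorem thetaDistLM_twistLM_ratGL (Φ : piSchwartzBruhat F (Fin n)) (γ : GL (Fin n) F) :
    thetaDistLM F (Fin n) (twistLM F (ratGL F γ) Φ) = thetaDistLM F (Fin n) Φ := by
  rw [thetaDistLM_apply, coe_twistLM, thetaDist_twist_ratGL, thetaDistLM_apply]

/-- **`θ_{Φ(·γ)}(x) = θ_Φ(xγ)`** for `γ ∈ GL_n(F)`: the theta function of a rational twist is the twisted theta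
function (`(x + ξ)γ = xγ + ξγ` and reindexing). [folklore] -/
theorem thetaFun_twist_ratGL (Φ : (Fin n → AdeleRing (𝓞 F) F) → ℂ) (γ : GL (Fin n) F)
    (x : Fin n → AdeleRing (𝓞 F) F) :
    thetaFun F (Fin n) (twist F (ratGL F γ) Φ) x =
      thetaFun F (Fin n) Φ (x ᵥ* ((ratGL F γ : GL (Fin n) (AdeleRing (𝓞 F) F)) :
        Matrix (Fin n) (Fin n) (AdeleRing (𝓞 F) F))) := by
  simp only [thetaFun, twist_apply, Matrix.add_vecMul]
  have h : ∀ ξ : Fin n → F,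
      Φ (x ᵥ* ((ratGL F γ : GL (Fin n) (AdeleRing (𝓞 F) F)) : Matrix (Fin n) (Fin n) (AdeleRing (𝓞 F) F)) +
        ratPt F (Fin n) ξ ᵥ* ((ratGL F γ : GL (Fin n) (AdeleRing (𝓞 F) F)) :
          Matrix (Fin n) (Fin n) (AdeleRing (𝓞 F) F))) =
      Φ (x ᵥ* ((ratGL F γ : GL (Fin n) (AdeleRing (𝓞 F) F)) : Matrix (Fin n) (Fin n) (AdeleRing (𝓞 F) F)) +
        ratPt F (Fin n) (MirabolicEisensteinSeries.vecMulEquiv γ ξ)) := fun ξ => by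
    rw [vecMulEquiv_apply, ratPt_vecMul]
  simp_rw [h]
  exact (MirabolicEisensteinSeries.vecMulEquiv γ).toEquiv.tsum_eq fun ξ =>
    Φ (x ᵥ* ((ratGL F γ : GL (Fin n) (AdeleRing (𝓞 F) F)) : Matrix (Fin n) (Fin n) (AdeleRing (𝓞 F) F)) +
      ratPt F (Fin n) ξ)

/-- `θ_{Φ(·g)}(x) = θ-type series twisted`: for a GENERAL `g ∈ GL_n(𝔸_F)` the theta function of the twist at `x`
is the series `Σ_ξ Φ(x g + ξ g)` (no reindexing available unless `g` is rational). [folklore] -/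
theorem thetaFun_twist (g : GL (Fin n) (AdeleRing (𝓞 F) F)) (Φ : (Fin n → AdeleRing (𝓞 F) F) → ℂ)
    (x : Fin n → AdeleRing (𝓞 F) F) :
    thetaFun F (Fin n) (twist F g Φ) x =
      ∑' ξ : Fin n → F, Φ (x ᵥ* (g : Matrix (Fin n) (Fin n) (AdeleRing (𝓞 F) F)) +
        ratPt F (Fin n) ξ ᵥ* (g : Matrix (Fin n) (Fin n) (AdeleRing (𝓞 F) F))) := by
  simp only [thetaFun, twist_apply, Matrix.add_vecMul]

end Twist

/-! ### The Fourier transform on `𝒮(X_A)` and Poisson summation as `Θ`-invariance -/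

section Fourier

variable (F : Type) [Field F] [NumberField F] (ι : Type) [Fintype ι]
  [MeasurableSpace (AdeleRing (𝓞 F) F)] [BorelSpace (AdeleRing (𝓞 F) F)]
  (ν : Measure (ι → AdeleRing (𝓞 F) F)) [ν.IsAddHaarMeasure]

/-- **The adelic Fourier transform as a linear endomorphism of `𝒮(X_A)`** (the tree's `adelicPiFourier` for
the pairing `Σ_i η_i v_i` and Tate's character, and its stability theorem `adelicPiFourier_mem_piSchwartzBruhat`).
[cite: CasselsFrohlichANT1967, Ch. XV (Tate), §4.2] -/
def fourierLM : piSchwartzBruhat F ι →ₗ[ℂ] piSchwartzBruhat F ι where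
  toFun Φ := ⟨adelicPiFourier F ι ν (Φ : (ι → AdeleRing (𝓞 F) F) → ℂ), adelicPiFourier_mem_piSchwartzBruhat Φ.2⟩
  map_add' Φ Ψ := by
    apply Subtype.ext
    simp only [Submodule.coe_add]
    exact adelicPiFourier_add F ι ν (integrable_of_mem_piSchwartzBruhat Φ.2)
      (integrable_of_mem_piSchwartzBruhat Ψ.2)
  map_smul' a Φ := by
    apply Subtype.ext
    simp only [Submodule.coe_smul, RingHom.id_apply]
    exact adelicPiFourier_smul F ι ν a _

variable {F ι ν}

/-- Unfolding of `fourierLM` on underlying functions. [folklore] -/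
@[simp] theorem coe_fourierLM (Φ : piSchwartzBruhat F ι) :
    ((fourierLM F ι ν Φ : piSchwartzBruhat F ι) : (ι → AdeleRing (𝓞 F) F) → ℂ) =
      adelicPiFourier F ι ν (Φ : (ι → AdeleRing (𝓞 F) F) → ℂ) := rfl

/-- The Tate domain `D^ι` has finite, non-zero Haar measure, so `0 < ν(D^ι).toReal`. [folklore] -/
theorem measure_piFundamentalDomain_toReal_pos : 0 < (ν (piFundamentalDomain F ι)).toReal := by
  haveI := locallyCompactSpace_adeleRing' F
  haveI := secondCountableTopology_adeleRing F
  haveI : Countable F := NumberField.countable' (K := F)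
  haveI : BorelSpace (ι → AdeleRing (𝓞 F) F) := Pi.borelSpace
  have hfin : ν (piFundamentalDomain F ι) ≠ ⊤ :=
    ((measure_mono subset_closure).trans_lt (isCompact_closure_piFundamentalDomain F ι).measure_lt_top).ne
  exact ENNReal.toReal_pos (Literature.Analysis.Fourier.measure_fundamentalDomain_ne_zero ν
    (isAddFundamentalDomain_op_piFundamentalDomain F ι ν)) hfin

/-- **Poisson summation as a transformation law of `Θ`**: `Θ(Φ̂) = ν(D^ι) · Θ(Φ)` for `Φ ∈ 𝒮(X_A)` and every
additive Haar measure `ν` on `X_A` (the tree's `tsum_eq_inv_measure_mul_tsum_adelicPiFourier`, Tate's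
Riemann–Roch theorem for the vector group, solved for `Θ(Φ̂)`). [cite: CasselsFrohlichANT1967, Ch. XV (Tate),
Lemma 4.2.4] -/
theorem thetaDist_adelicPiFourier {Φ : (ι → AdeleRing (𝓞 F) F) → ℂ} (hΦ : Φ ∈ piSchwartzBruhat F ι) :
    thetaDist F ι (adelicPiFourier F ι ν Φ) = (ν (piFundamentalDomain F ι)).toReal * thetaDist F ι Φ := by
  have hc : ((ν (piFundamentalDomain F ι)).toReal : ℂ) ≠ 0 :=
    Complex.ofReal_ne_zero.2 (measure_piFundamentalDomain_toReal_pos (ν := ν)).ne'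
  have h := tsum_eq_inv_measure_mul_tsum_adelicPiFourier (ν := ν) hΦ
  change thetaDist F ι Φ = _ * thetaDist F ι (adelicPiFourier F ι ν Φ) at h
  rw [h, ← mul_assoc, Complex.ofReal_inv, mul_inv_cancel₀ hc, one_mul]

/-- **`Θ(Φ̂) = Θ(Φ)` for the self-dual normalisation `ν(D^ι) = 1`** — the invariance conjunct of
[Weil1964, Thm 6] for the Weyl-element generator of `Ps(X)_k`, in the concrete model.
[cite: Weil1964, Chap. III n° 41, Thm 6 p. 193] -/
theorem thetaDist_adelicPiFourier_of_measure_eq_one {Φ : (ι → AdeleRing (𝓞 F) F) → ℂ}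
    (hΦ : Φ ∈ piSchwartzBruhat F ι) (hν : ν (piFundamentalDomain F ι) = 1) :
    thetaDist F ι (adelicPiFourier F ι ν Φ) = thetaDist F ι Φ := by
  rw [thetaDist_adelicPiFourier hΦ, hν, ENNReal.toReal_one, Complex.ofReal_one, one_mul]

/-- The same for the packaged operator `fourierLM`. [folklore] -/
theorem thetaDistLM_fourierLM (Φ : piSchwartzBruhat F ι) :
    thetaDistLM F ι (fourierLM F ι ν Φ) = (ν (piFundamentalDomain F ι)).toReal * thetaDistLM F ι Φ := by
  rw [thetaDistLM_apply, coe_fourierLM, thetaDist_adelicPiFourier Φ.2, thetaDistLM_apply]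

/-- `Θ ∘ 𝓕 = Θ` on `𝒮(X_A)` for the self-dual normalisation. [folklore] -/
theorem thetaDistLM_fourierLM_of_measure_eq_one (Φ : piSchwartzBruhat F ι) (hν : ν (piFundamentalDomain F ι) = 1) :
    thetaDistLM F ι (fourierLM F ι ν Φ) = thetaDistLM F ι Φ := by
  rw [thetaDistLM_apply, coe_fourierLM, thetaDist_adelicPiFourier_of_measure_eq_one Φ.2 hν, thetaDistLM_apply]

end Fourier

/-! ### Packaging: the concrete `ThetaSeriesDatum` / `WeilThetaDatum` and the stabiliser of `Θ` -/

section Packaging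

variable (F : Type) [Field F] [NumberField F] (ι : Type) [Fintype ι]

/-- **The concrete theta-series datum of `X = F^ι`**: `Mp := (Module.End ℂ 𝒮(X_A))ˣ` — the group of ALL
invertible linear operators of `𝒮(X_A)`, through which any metaplectic-type group acts — acting tautologically,
`SX := 𝒮(X_A)`, `X_k := F^ι`, evaluation at principal points. [cite: Weil1964, Chap. III n° 41, Thm 6 p. 193] -/
def schwartzBruhatThetaSeriesDatum :
    ThetaSeriesDatum (Module.End ℂ (piSchwartzBruhat F ι))ˣ (piSchwartzBruhat F ι) (ι → F) where
  act S Φ := (S : Module.End ℂ (piSchwartzBruhat F ι)) Φ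
  ev Φ ξ := (Φ : (ι → AdeleRing (𝓞 F) F) → ℂ) (ratPt F ι ξ)

variable {F ι}

/-- Unfolding of the action. [folklore] -/
@[simp] theorem schwartzBruhatThetaSeriesDatum_act (S : (Module.End ℂ (piSchwartzBruhat F ι))ˣ)
    (Φ : piSchwartzBruhat F ι) :
    (schwartzBruhatThetaSeriesDatum F ι).act S Φ = (S : Module.End ℂ (piSchwartzBruhat F ι)) Φ := rfl

/-- Unfolding of the evaluation. [folklore] -/
@[simp] theorem schwartzBruhatThetaSeriesDatum_ev (Φ : piSchwartzBruhat F ι) (ξ : ι → F) :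
    (schwartzBruhatThetaSeriesDatum F ι).ev Φ ξ = (Φ : (ι → AdeleRing (𝓞 F) F) → ℂ) (ratPt F ι ξ) := rfl

/-- **Weil's theta series in the concrete model is the theta distribution of `SΦ`**:
`Θ_Φ(S) = Σ_{ξ ∈ X_k} (SΦ)(ξ) = Θ(SΦ)`. [cite: Weil1964, Chap. III n° 41, Thm 6 p. 193] -/
theorem thetaSeries_eq_thetaDist (Φ : piSchwartzBruhat F ι) (S : (Module.End ℂ (piSchwartzBruhat F ι))ˣ) :
    (schwartzBruhatThetaSeriesDatum F ι).thetaSeries Φ S =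
      thetaDist F ι (((S : Module.End ℂ (piSchwartzBruhat F ι)) Φ : piSchwartzBruhat F ι) :
        (ι → AdeleRing (𝓞 F) F) → ℂ) := rfl

/-- **Absolute convergence of the theta series at every `S`** (Weil's Lemme 5 in the concrete model: `SΦ` is
again Schwartz–Bruhat). [cite: Weil1964, Chap. III n° 41, Lemme 5 p. 194] -/
theorem absSummableAt (Φ : piSchwartzBruhat F ι) (S : (Module.End ℂ (piSchwartzBruhat F ι))ˣ) :
    (schwartzBruhatThetaSeriesDatum F ι).AbsSummableAt Φ S :=
  summable_norm_ratPt ((S : Module.End ℂ (piSchwartzBruhat F ι)) Φ).2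

variable (F ι) in
/-- **The stabiliser of `Θ`**: the subgroup of invertible linear operators `S` of `𝒮(X_A)` with
`Θ(SΦ) = Θ(Φ)` for all `Φ`. The rational generators of the pseudo-symplectic group lie in it
(`twistUnit_ratGL_mem_thetaStabilizer`; second-degree characters and the normalised Fourier transform in the
sequel files). [folklore] -/
def thetaStabilizer : Subgroup (Module.End ℂ (piSchwartzBruhat F ι))ˣ where
  carrier := {S | ∀ Φ : piSchwartzBruhat F ι,
    thetaDistLM F ι ((S : Module.End ℂ (piSchwartzBruhat F ι)) Φ) = thetaDistLM F ι Φ}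
  one_mem' := fun Φ => rfl
  mul_mem' := by
    intro S T hS hT Φ
    rw [Units.val_mul, Module.End.mul_apply, hS, hT]
  inv_mem' := by
    intro S hS Φ
    have h := hS ((↑S⁻¹ : Module.End ℂ (piSchwartzBruhat F ι)) Φ)
    rw [← Module.End.mul_apply, ← Units.val_mul, mul_inv_cancel, Units.val_one, Module.End.one_apply] at h
    exact h.symm

/-- Membership in the stabiliser. [folklore] -/
theorem mem_thetaStabilizer_iff (S : (Module.End ℂ (piSchwartzBruhat F ι))ˣ) :
    S ∈ thetaStabilizer F ι ↔ ∀ Φ : piSchwartzBruhat F ι,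
      thetaDistLM F ι ((S : Module.End ℂ (piSchwartzBruhat F ι)) Φ) = thetaDistLM F ι Φ := Iff.rfl

/-- **The rational points of `GL_n` stabilise `Θ`.** [cite: Weil1964, Chap. III n° 41, Thm 6 p. 193] -/
theorem twistUnit_ratGL_mem_thetaStabilizer {n : ℕ} (γ : GL (Fin n) F) :
    twistUnit F n (ratGL F γ) ∈ thetaStabilizer F (Fin n) := fun Φ => by
  rw [coe_twistUnit]
  exact thetaDistLM_twistLM_ratGL Φ γ

variable (F ι) in
/-- **The concrete `WeilThetaDatum` of `X = F^ι`** (carriers of `ThetaDistribution.lean`): the tautological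
action of the invertible operators of `𝒮(X_A)`, `rat := thetaStabilizer`, `theta :=` Weil's series.
[cite: Weil1964, Chap. III n° 41, Thm 6 p. 193] -/
def schwartzBruhatWeilThetaDatum :
    WeilThetaDatum (Module.End ℂ (piSchwartzBruhat F ι))ˣ (piSchwartzBruhat F ι) :=
  (schwartzBruhatThetaSeriesDatum F ι).toWeilThetaDatum (thetaStabilizer F ι : Set _)

/-- `theta Φ S = Θ(SΦ)`. [folklore] -/
theorem schwartzBruhatWeilThetaDatum_theta (Φ : piSchwartzBruhat F ι)
    (S : (Module.End ℂ (piSchwartzBruhat F ι))ˣ) :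
    (schwartzBruhatWeilThetaDatum F ι).theta Φ S =
      thetaDistLM F ι ((S : Module.End ℂ (piSchwartzBruhat F ι)) Φ) := rfl

/-- `rat = thetaStabilizer`. [folklore] -/
theorem schwartzBruhatWeilThetaDatum_rat :
    (schwartzBruhatWeilThetaDatum F ι).rat = (thetaStabilizer F ι : Set _) := rfl

/-- `act S Φ = SΦ`. [folklore] -/
theorem schwartzBruhatWeilThetaDatum_act (S : (Module.End ℂ (piSchwartzBruhat F ι))ˣ)
    (Φ : piSchwartzBruhat F ι) :
    (schwartzBruhatWeilThetaDatum F ι).act S Φ = (S : Module.End ℂ (piSchwartzBruhat F ι)) Φ := rfl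

/-- **THE INVARIANCE CONJUNCT OF THÉORÈME 6 IN THE CONCRETE MODEL, PROVED**: `Θ_Φ(γ S) = Θ_Φ(S)` for every
`γ ∈ rat`, every `S` and every `Φ ∈ 𝒮(X_A)` (second conjunct of `WeilThetaDatum.ThetaContinuousInvariant`).
[cite: Weil1964, Chap. III n° 41, Thm 6 p. 193] -/
theorem schwartzBruhatWeilThetaDatum_theta_invariant (Φ : piSchwartzBruhat F ι)
    (γ : (Module.End ℂ (piSchwartzBruhat F ι))ˣ) (hγ : γ ∈ (schwartzBruhatWeilThetaDatum F ι).rat)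
    (S : (Module.End ℂ (piSchwartzBruhat F ι))ˣ) :
    (schwartzBruhatWeilThetaDatum F ι).theta Φ (γ * S) = (schwartzBruhatWeilThetaDatum F ι).theta Φ S := by
  rw [schwartzBruhatWeilThetaDatum_theta, schwartzBruhatWeilThetaDatum_theta, Units.val_mul,
    Module.End.mul_apply]
  exact hγ _

/-- The invariance conjunct in the exact shape of `ThetaContinuousInvariant`'s second component. [folklore] -/
theorem schwartzBruhatWeilThetaDatum_invariance :
    ∀ (Φ : piSchwartzBruhat F ι) (γ : (Module.End ℂ (piSchwartzBruhat F ι))ˣ),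
      γ ∈ (schwartzBruhatWeilThetaDatum F ι).rat →
      ∀ S : (Module.End ℂ (piSchwartzBruhat F ι))ˣ,
        (schwartzBruhatWeilThetaDatum F ι).theta Φ (γ * S) = (schwartzBruhatWeilThetaDatum F ι).theta Φ S :=
  fun Φ γ hγ S => schwartzBruhatWeilThetaDatum_theta_invariant Φ γ hγ S

/-- **`Θ_Φ(γ) = Θ(Φ)` for `γ ∈ GL_n(F)`** through the packaged datum. [folklore] -/
theorem schwartzBruhatWeilThetaDatum_theta_ratGL {n : ℕ} (Φ : piSchwartzBruhat F (Fin n)) (γ : GL (Fin n) F) :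
    (schwartzBruhatWeilThetaDatum F (Fin n)).theta Φ (twistUnit F n (ratGL F γ)) = thetaDistLM F (Fin n) Φ := by
  rw [schwartzBruhatWeilThetaDatum_theta, coe_twistUnit]
  exact thetaDistLM_twistLM_ratGL Φ γ

end Packaging

end Literature.NumberTheory.Weil1964

end
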